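import Literature.AlgebraicGeometry.Resolution.RegularLocalRingsNormal
import Summits.ResolutionOfSingularities.ResolutionOfSingularities.Theorems.FrobeniusClosingCampaignW41FormalTorsorLemmas
import Mathlib.Algebra.CharP.Two
import HarnessLib

/-!
# Crux `Steer` (stmt-ResolutionOfSingularities-16345), chain W4.1, E-ROW row 9 (R3) `EvenResidueLettersHeavyTwoN`, brick F1:
# the ORDER OF A PRODUCT in a regular local ring (Thm. 17.10: `gr_𝔪` is a domain), and the abstract ODD-CLASS BOUND (Lemma O) —
# a derivation reading `π(D Φ) = π(c)²` with `π c ∉ 𝔫^e` forbids `Φ − h² ∈ 𝔪^(2e)` in characteristic `2`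

OURS (campaign `res-hironaka`, rung L ★L-G4, slot W4.1; seat res-L0-w41-stub-3 g8, res-L0-w41-plan-1 RULING 266 (e) «stub-3 → (R3) kernel»; route =
res-L0-w41-idea-2 `g13/R3-PROOF-MAP.md` eab63904c0a3ca30 §3 (O) in the log-derivation variant it lists; replaces the role of no printed item; NOT a
statement of the manuscript under review [claim: Hironaka2017, status: under-review]; AI-produced, weaker than expert review). Theses-free, definition-free.

* `RegularOrder.not_mem_pow_succ_mul` — in a regular local ring, `a ∉ 𝔪^(i+1)` and `b ∉ 𝔪^(j+1)` give `a·b ∉ 𝔪^(i+j+1)` (initial forms multiply in the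
  DOMAIN `κ[X]`, tree `exists_isHomogeneous_eval_eq_map_ne_zero` / `map_residue_eq_zero_of_eval_mem_pow_succ`, Matsumura Thm. 17.10);
* `RegularOrder.not_sq_mem_pow_of_not_mem_pow` — hence `c ∉ 𝔪^e ⇒ c² ∉ 𝔪^(2e−1)` (`e ≥ 1`);
* `RegularOrder.derivation_sub_sq` — in characteristic `2` a derivation does not see a square: `D (Φ − h²) = D Φ`;
* `RegularOrder.not_sub_sq_mem_pow_of_derivation` — **Lemma O (abstract)**: `B` local of characteristic `2`, `π : B → S̄` a ring hom to a REGULAR local ring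
  with `π(𝔪_B) ⊆ 𝔫`, `D ∈ Der_ℤ(B)` with `π (D Φ) = (π c)² + π r`, `r ∈ 𝔪_B^(2e−1)`, and `π c ∉ 𝔫^e` (`e ≥ 1`) ⟹ `Φ − h² ∉ 𝔪_B^(2e)` for every `h`.
[cite: Matsumura1987, Thm. 17.10] [folklore]
-/

noncomputable section

set_option linter.dupNamespace false

open IsLocalRing MvPolynomial
open Literature.AlgebraicGeometry.Resolution

namespace Summit.ResolutionOfSingularities.ResolutionOfSingularities.Theorems.SwitchingDichotomy.RegularOrder

/-! ## The order of a product in a regular local ring -/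

/-- A form of degree `n` in generators of `𝔪` with NON-ZERO reduction, whose value avoids `𝔪^(i+1)`, has `n ≤ i`. [folklore] -/
theorem degree_le_of_eval_not_mem {R : Type} [CommRing R] [IsLocalRing R] {d : ℕ} (x : Fin d → R)
    (hx : Ideal.span (Set.range x) = maximalIdeal R) {n i : ℕ} {F : MvPolynomial (Fin d) R} (hF : F.IsHomogeneous n)
    (ha : eval x F ∉ maximalIdeal R ^ (i + 1)) : n ≤ i := by
  by_contra hlt
  apply ha
  have hmem : eval x F ∈ maximalIdeal R ^ n := hx ▸ eval_mem_span_pow x hF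
  exact Ideal.pow_le_pow_right (by omega) hmem

/-- **Order is additive on products in a regular local ring (upper bound form).** If `a ∉ 𝔪^(i+1)` and `b ∉ 𝔪^(j+1)` then `a·b ∉ 𝔪^(i+j+1)`: the initial
forms `F̄, Ḡ ∈ κ[X]` of `a`, `b` are non-zero of degrees `≤ i`, `≤ j`, and `F̄·Ḡ ≠ 0` is the reduction of the form `F·G` representing `a·b`
(Matsumura Thm. 17.10: a form whose value lies one power deeper reduces to zero). [cite: Matsumura1987, Thm. 17.10] [folklore] -/
theorem not_mem_pow_succ_mul {R : Type} [CommRing R] [IsRegularLocalRing R] {a b : R} {i j : ℕ}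
    (ha : a ∉ maximalIdeal R ^ (i + 1)) (hb : b ∉ maximalIdeal R ^ (j + 1)) : a * b ∉ maximalIdeal R ^ (i + j + 1) := by
  classical
  have ha0 : a ≠ 0 := fun h => ha (h ▸ Ideal.zero_mem _)
  have hb0 : b ≠ 0 := fun h => hb (h ▸ Ideal.zero_mem _)
  obtain ⟨x, hx⟩ := exists_regularSystemOfParameters (R := R)
  obtain ⟨n, F, hF, hFa, hF0⟩ := exists_isHomogeneous_eval_eq_map_ne_zero x hx ha0
  obtain ⟨n', G, hG, hGb, hG0⟩ := exists_isHomogeneous_eval_eq_map_ne_zero x hx hb0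
  have hn : n ≤ i := degree_le_of_eval_not_mem x hx hF (hFa ▸ ha)
  have hn' : n' ≤ j := degree_le_of_eval_not_mem x hx hG (hGb ▸ hb)
  -- the product form and its non-zero reduction (`κ[X]` is a domain)
  have hFG : (F * G).IsHomogeneous (n + n') := hF.mul hG
  have hFG0 : map (residue R) (F * G) ≠ 0 := by
    rw [map_mul]; exact mul_ne_zero hF0 hG0
  intro hab
  have hab' : eval x (F * G) ∈ maximalIdeal R ^ (n + n' + 1) := by
    rw [map_mul, hFa, hGb]
    exact Ideal.pow_le_pow_right (by omega) hab
  exact hFG0 (map_residue_eq_zero_of_eval_mem_pow_succ rfl x hx hFG hab')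

/-- **A non-member of `𝔪^e` squares outside `𝔪^(2e−1)`** (`e ≥ 1`) in a regular local ring. [cite: Matsumura1987, Thm. 17.10] [folklore] -/
theorem not_sq_mem_pow_of_not_mem_pow {R : Type} [CommRing R] [IsRegularLocalRing R] {c : R} {e : ℕ} (he : 1 ≤ e)
    (hc : c ∉ maximalIdeal R ^ e) : c ^ 2 ∉ maximalIdeal R ^ (2 * e - 1) := by
  obtain ⟨e', rfl⟩ : ∃ e', e = e' + 1 := ⟨e - 1, by omega⟩
  have h := not_mem_pow_succ_mul hc hc
  have heq : 2 * (e' + 1) - 1 = e' + e' + 1 := by omega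
  rw [heq, pow_two]
  exact h

/-! ## Lemma O (abstract): a derivation reading forbids deep squares in characteristic `2` -/

/-- In characteristic `2` a derivation does not see squares: `D (Φ − h²) = D Φ`. [folklore] -/
theorem derivation_sub_sq {B : Type} [CommRing B] [CharP B 2] (D : Derivation ℤ B B) (Φ h : B) : D (Φ - h ^ 2) = D Φ := by
  have h2 : D (h ^ 2) = 0 := by
    rw [pow_two, Derivation.leibniz, smul_eq_mul, ← two_mul, ← mul_assoc]
    rw [show (2 : B) * h = 0 from by rw [CharTwo.two_eq_zero, zero_mul], zero_mul]
  rw [map_sub, h2, sub_zero]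

/-- **Lemma O (abstract odd-class bound).** Let `B` be a local ring of characteristic `2`, `π : B → S̄` a ring hom to a REGULAR local ring with
`π(𝔪_B) ⊆ 𝔫_{S̄}`, `D ∈ Der_ℤ(B)`, and `Φ, c, r ∈ B` with `π (D Φ) = (π c)² + π r`, `r ∈ 𝔪_B^(2e−1)`, `π c ∉ 𝔫^e`, `e ≥ 1`. Then NO `h ∈ B` has
`Φ − h² ∈ 𝔪_B^(2e)`: otherwise `D Φ = D(Φ − h²) ∈ 𝔪_B^(2e−1)`, so `(π c)² ∈ 𝔫^(2e−1)`, against `not_sq_mem_pow_of_not_mem_pow`.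
[cite: Matsumura1987, Thm. 17.10] [folklore] -/
theorem not_sub_sq_mem_pow_of_derivation {B S : Type} [CommRing B] [IsLocalRing B] [CharP B 2] [CommRing S] [IsRegularLocalRing S]
    (π : B →+* S) (hπ : (maximalIdeal B).map π ≤ maximalIdeal S) (D : Derivation ℤ B B) {Φ c r : B} {e : ℕ} (he : 1 ≤ e)
    (hD : π (D Φ) = π c ^ 2 + π r) (hr : r ∈ maximalIdeal B ^ (2 * e - 1)) (hc : π c ∉ maximalIdeal S ^ e) (h : B) :
    Φ - h ^ 2 ∉ maximalIdeal B ^ (2 * e) := by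
  intro hmem
  have hpow : ∀ {N : ℕ} {y : B}, y ∈ maximalIdeal B ^ N → π y ∈ maximalIdeal S ^ N := fun {N} {y} hy => by
    have := Ideal.pow_right_mono (I := (maximalIdeal B).map π) hπ N
    rw [← Ideal.map_pow] at this
    exact this (Ideal.mem_map_of_mem π hy)
  -- `D Φ ∈ 𝔪_B^(2e−1)`
  have hDΦ : D Φ ∈ maximalIdeal B ^ (2 * e - 1) := by
    rw [← derivation_sub_sq D Φ h]
    have h2e : 2 * e = (2 * e - 1) + 1 := by omega
    rw [h2e] at hmem
    exact Derivation.apply_mem_pow_of_mem_pow_succ D (maximalIdeal B) (2 * e - 1) hmem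
  -- hence `(π c)² ∈ 𝔫^(2e−1)`
  have hsq : π c ^ 2 ∈ maximalIdeal S ^ (2 * e - 1) := by
    have h1 : π (D Φ) - π r ∈ maximalIdeal S ^ (2 * e - 1) := Ideal.sub_mem _ (hpow hDΦ) (hpow hr)
    rwa [hD, add_sub_cancel_right] at h1
  exact not_sq_mem_pow_of_not_mem_pow he hc hsq

end Summit.ResolutionOfSingularities.ResolutionOfSingularities.Theorems.SwitchingDichotomy.RegularOrder

end
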